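import Literature.Geometry.Symplectic.PencilEndLeafCoords
import Mathlib.Analysis.Calculus.Deriv.Inv
import Mathlib.Analysis.Calculus.ContDiff.Operations
import Mathlib.Geometry.Manifold.ContMDiff.NormedSpace
import Mathlib.Geometry.Manifold.ContMDiff.Constructions
import HarnessLib

/-!
# The family of renormalised leaves: smooth coefficients, joint smoothness, injective differential

Support file (no new facts, D-0026) for the glue
`jPlanePencil_localFamily_homotopySphere ⟸ hls_localFoliation_embeddedSphere_trivialNormal`
(C. Wendl, *Holomorphic Curves in Low Dimensions* (2018), proof of Prop. 2.53, p. 65).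

§1 `PencilEnd.leafCoeff`: the renormalisation constants `c_a = g_a'(wz a)`, `g_a''(wz a)` of the
leaf `a` (`g_a w = (boxCoord (V a w)).1` holomorphic on `‖w‖ < r₂`) are `C^∞` functions of `a`
(the real partial derivatives of the jointly smooth `(a, w) ↦ (boxCoord (V a w)).1` along the
smooth graph of `wz`).

§2 `PencilEnd.leafJoint`: with the intercept chart `α` (smooth, `dα` bijective) and smooth
`wz`, `cf ≠ 0`, `df`, a family `Floc : ℂ → ℂ → M ∖ p` read in the leaves through the two pieces
of the puncture parametrisation — `inP (Floc b ξ) = U (α b) (ξ'/(1 + w₀ ξ'))` where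
`1 + w₀ ξ' ≠ 0` and `inP (Floc b ξ) = V (α b) (w₀ + ξ'⁻¹)` where `ξ' ≠ 0` (`ξ' = cf a (ξ − df a)`,
`w₀ = wz a`, `a = α b`) — is jointly `C^∞` on `ball b₀ δ ×ˢ univ` with injective differential,
and so is each slice `Floc b` (`Floc = inPInv ∘ Ev ∘ Ψ` on each piece, `dΨ` block triangular
with diagonal blocks `dα` and `cf a · m'(ξ') ≠ 0`).

Literature-side analogues of the summit helpers `helper_leafFloc_coeff`, `helper_leafFloc_joint`
(`Summits/SmoothPoincare4/…/SullivanDualWitnessChargeV15LeafFloc{Coeff,Joint}.lean`).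

## References

* C. Wendl, *Holomorphic Curves in Low Dimensions*, LNM 2216 (2018), proof of Prop. 2.53. [Wendl2018]
-/

noncomputable section

open scoped Manifold ContDiff Topology
open Set Function Filter Metric Complex Literature.Topology.FourManifolds

namespace Literature.Geometry.Symplectic

/-! ### Generic calculus lemmas -/

/-- **Complex derivative of a holomorphic slice = real partial derivative.** If `G : ℂ × ℂ → ℂ` is
real differentiable at `(a, w)` and the slice `w ↦ G (a, w)` is complex differentiable at `w`, then
`deriv (G (a, ·)) w = fderiv ℝ G (a, w) (0, 1)`. [folklore] -/
theorem deriv_slice_eq_fderiv {G : ℂ × ℂ → ℂ} {a w : ℂ} (hG : DifferentiableAt ℝ G (a, w))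
    (hg : DifferentiableAt ℂ (fun w' => G (a, w')) w) :
    deriv (fun w' => G (a, w')) w = fderiv ℝ G (a, w) (0, 1) := by
  have h1 : HasFDerivAt (fun w' => G (a, w')) ((fderiv ℝ G (a, w)).comp
      (ContinuousLinearMap.inr ℝ ℂ ℂ)) w :=
    hG.hasFDerivAt.comp w (hasFDerivAt_prodMk_right a w)
  have h2 : HasFDerivAt (fun w' => G (a, w'))
      ((ContinuousLinearMap.smulRight (1 : ℂ →L[ℂ] ℂ)
        (deriv (fun w' => G (a, w')) w)).restrictScalars ℝ) w :=
    hg.hasDerivAt.hasFDerivAt.restrictScalars ℝ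
  have e := congrArg (fun M : ℂ →L[ℝ] ℂ => M 1) (h1.unique h2)
  simpa using e.symm

/-- A block lower-triangular real-linear map `v ↦ (A v.1, L v)` of `ℂ × ℂ` with `A` injective and
`L (0, v₂) = v₂ κ`, `κ ≠ 0`, is injective. [folklore] -/
theorem injective_blockTriangular {A : ℂ →L[ℝ] ℂ} {L : ℂ × ℂ →L[ℝ] ℂ} {κ : ℂ}
    (hA : Injective A) (hL : ∀ v : ℂ, L (0, v) = v * κ) (hκ : κ ≠ 0) :
    Injective ((A.comp (ContinuousLinearMap.fst ℝ ℂ ℂ)).prod L) := by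
  refine (injective_iff_map_eq_zero _).2 fun v hv => ?_
  rw [ContinuousLinearMap.prod_apply, Prod.mk_eq_zero] at hv
  obtain ⟨h1, h2⟩ := hv
  have hv1 : v.1 = 0 := (injective_iff_map_eq_zero A).1 hA _ h1
  have hv' : v = (0, v.2) := Prod.ext hv1 rfl
  rw [hv', hL] at h2
  exact Prod.ext hv1 ((mul_eq_zero.1 h2).resolve_right hκ)

namespace PencilEnd

variable {M : Type*} [TopologicalSpace M] [ChartedSpace (EuclideanSpace ℝ (Fin 4)) M] [T2Space M]
  [IsManifold (𝓡 4) ∞ M] {p : M} (G : PencilEnd p)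

/-- **`d inPInv = id` at points of `range inP`.** [folklore] -/
theorem hasMFDerivAt_inPInv (x : punctured p) :
    HasMFDerivAt (𝓡 4) (𝓡 4) G.inPInv (G.inP x)
      (ContinuousLinearMap.id ℝ (EuclideanSpace ℝ (Fin 4))) := by
  have hn : (∞ : WithTop ℕ∞) ≠ 0 := by simp
  have hd : MDifferentiableAt (𝓡 4) (𝓡 4) G.inPInv (G.inP x) :=
    (G.contMDiffOn_inPInv.contMDiffAt (G.isOpen_range_inP.mem_nhds ⟨x, rfl⟩)).mdifferentiableAt hn
  have hcomp : HasMFDerivAt (𝓡 4) (𝓡 4) (G.inPInv ∘ G.inP) x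
      ((mfderiv (𝓡 4) (𝓡 4) G.inPInv (G.inP x)).comp
        (ContinuousLinearMap.id ℝ (TangentSpace (𝓡 4) x))) :=
    hd.hasMFDerivAt.comp x (G.hasMFDerivAt_inP x)
  have hid : HasMFDerivAt (𝓡 4) (𝓡 4) (G.inPInv ∘ G.inP) x
      (ContinuousLinearMap.id ℝ (TangentSpace (𝓡 4) x)) :=
    (hasMFDerivAt_id (I := 𝓡 4) x).congr_of_eventuallyEq (Eventually.of_forall fun z => G.inPInv_inP z)
  have e : (mfderiv (𝓡 4) (𝓡 4) G.inPInv (G.inP x)).comp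
      (ContinuousLinearMap.id ℝ (TangentSpace (𝓡 4) x)) =
      ContinuousLinearMap.id ℝ (TangentSpace (𝓡 4) x) := hcomp.mfderiv.symm.trans hid.mfderiv
  exact hd.hasMFDerivAt.congr_mfderiv (ContinuousLinearMap.ext fun v => ContinuousLinearMap.ext_iff.1 e v)

/-! ### §1 Smoothness of the renormalisation constants -/

/-- **The renormalisation constants are smooth in the leaf parameter.** See the module docstring.
[cite: Wendl2018, proof of Prop. 2.53 (p. 65)] -/
theorem leafCoeff {V : ℂ → ℂ → G.Y} {ε ε₁ r₂ : ℝ} {wz : ℂ → ℂ}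
    (hEvV : ContMDiffOn 𝓘(ℝ, ℂ × ℂ) (𝓡 4) ∞ (fun q : ℂ × ℂ => V q.1 q.2) (ball 0 ε ×ˢ univ))
    (hε₁ε : ε₁ ≤ ε) (hwz : ContDiffOn ℝ ∞ wz (ball 0 ε₁))
    (hwzr : ∀ a ∈ ball (0 : ℂ) ε₁, ‖wz a‖ < r₂)
    (hVcap : ∀ a ∈ ball (0 : ℂ) ε₁, ∀ w : ℂ, ‖w‖ ≤ r₂ → V a w ∈ range G.inB)
    (hVdiff : ∀ a ∈ ball (0 : ℂ) ε₁, DifferentiableOn ℂ (fun w => G.boxCoord (V a w)) (ball 0 r₂)) :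
    ContDiffOn ℝ ∞ (fun a => deriv (fun w => (G.boxCoord (V a w)).1) (wz a)) (ball 0 ε₁) ∧
    ContDiffOn ℝ ∞ (fun a => deriv (deriv (fun w => (G.boxCoord (V a w)).1)) (wz a)) (ball 0 ε₁) := by
  -- the real `C^∞` function `Gf (a, w) = x'(V a w)` on `O = ball 0 ε₁ ×ˢ ball 0 r₂`
  set Gf : ℂ × ℂ → ℂ := fun q => (G.boxCoord (V q.1 q.2)).1 with hGf
  set O : Set (ℂ × ℂ) := ball (0 : ℂ) ε₁ ×ˢ ball (0 : ℂ) r₂ with hO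
  have hOo : IsOpen O := isOpen_ball.prod isOpen_ball
  have hO2 : ∀ q ∈ O, ‖q.2‖ < r₂ := fun q hq => by
    have h := (mem_prod.1 hq).2
    rwa [Metric.mem_ball, dist_zero_right] at h
  have hGs : ContDiffOn ℝ ∞ Gf O := by
    have h1 : ContMDiffOn 𝓘(ℝ, ℂ × ℂ) (𝓡 4) ∞ (fun q : ℂ × ℂ => V q.1 q.2) O :=
      hEvV.mono (prod_mono (ball_subset_ball hε₁ε) (subset_univ _))
    have h2 : ContMDiffOn 𝓘(ℝ, ℂ × ℂ) 𝓘(ℝ, ℂ × ℂ) ∞ (fun q : ℂ × ℂ => G.boxCoord (V q.1 q.2)) O :=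
      G.contMDiffOn_boxCoord.comp h1 fun q hq => hVcap q.1 (mem_prod.1 hq).1 q.2 (hO2 q hq).le
    exact h2.contDiffOn.fst
  -- the first and second partial derivatives in `w`
  set G₁ : ℂ × ℂ → ℂ := fun q => fderiv ℝ Gf q (0, 1) with hG₁
  have hG₁s : ContDiffOn ℝ ∞ G₁ O :=
    (hGs.fderiv_of_isOpen hOo (by simp)).clm_apply contDiffOn_const
  set G₂ : ℂ × ℂ → ℂ := fun q => fderiv ℝ G₁ q (0, 1) with hG₂
  have hG₂s : ContDiffOn ℝ ∞ G₂ O :=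
    (hG₁s.fderiv_of_isOpen hOo (by simp)).clm_apply contDiffOn_const
  -- the holomorphic slices
  have hslice : ∀ a ∈ ball (0 : ℂ) ε₁, ∀ w ∈ ball (0 : ℂ) r₂,
      deriv (fun w' => (G.boxCoord (V a w')).1) w = G₁ (a, w) := by
    intro a ha w hw
    have hGd : DifferentiableAt ℝ Gf (a, w) :=
      (hGs.contDiffAt (hOo.mem_nhds (mk_mem_prod ha hw))).differentiableAt (by simp)
    have hgd : DifferentiableAt ℂ (fun w' => (G.boxCoord (V a w')).1) w :=
      ((hVdiff a ha).fst.differentiableAt (isOpen_ball.mem_nhds hw))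
    exact deriv_slice_eq_fderiv hGd hgd
  have hslice₂ : ∀ a ∈ ball (0 : ℂ) ε₁, ∀ w ∈ ball (0 : ℂ) r₂,
      deriv (deriv (fun w' => (G.boxCoord (V a w')).1)) w = G₂ (a, w) := by
    intro a ha w hw
    have hev : deriv (fun w' => (G.boxCoord (V a w')).1) =ᶠ[𝓝 w] fun w' => G₁ (a, w') :=
      Filter.eventuallyEq_of_mem (isOpen_ball.mem_nhds hw) fun w' hw' => hslice a ha w' hw'
    rw [hev.deriv_eq]
    have hG₁d : DifferentiableAt ℝ G₁ (a, w) :=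
      (hG₁s.contDiffAt (hOo.mem_nhds (mk_mem_prod ha hw))).differentiableAt (by simp)
    have hana : DifferentiableAt ℂ (deriv (fun w' => (G.boxCoord (V a w')).1)) w :=
      (((hVdiff a ha).fst.analyticOnNhd isOpen_ball).deriv w hw).differentiableAt
    have hg₁d : DifferentiableAt ℂ (fun w' => G₁ (a, w')) w := hana.congr_of_eventuallyEq hev.symm
    exact deriv_slice_eq_fderiv hG₁d hg₁d
  -- smoothness along the graph of `wz`
  have hgraph : ContDiffOn ℝ ∞ (fun a : ℂ => (a, wz a)) (ball 0 ε₁) := contDiffOn_id.prodMk hwz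
  have hgraphO : ∀ a ∈ ball (0 : ℂ) ε₁, (a, wz a) ∈ O := fun a ha =>
    mk_mem_prod ha (by rw [Metric.mem_ball, dist_zero_right]; exact hwzr a ha)
  refine ⟨(hG₁s.comp hgraph hgraphO).congr fun a ha => ?_,
    (hG₂s.comp hgraph hgraphO).congr fun a ha => ?_⟩
  · exact hslice a ha (wz a) (hgraphO a ha).2
  · exact hslice₂ a ha (wz a) (hgraphO a ha).2

/-! ### §2 Joint smoothness and injective differential -/

/-- **The differential of one piece `inPInv ∘ Ev ∘ Ψ` is injective.** Here `Ψ q = (α q.1, φ q)`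
with `dα` injective at `b` and `∂_ξ φ (b, ·) = κ ≠ 0` at `ξ`, `Ev` smooth on the open
`T ∋ Ψ (b, ξ)` with injective differential there, `Ev (Ψ (b, ξ)) = inP (Φ (b, ξ))`, and
`Φ = inPInv ∘ Ev ∘ Ψ` near `(b, ξ)`. [folklore] -/
theorem injective_mfderiv_of_piece {Ev : ℂ × ℂ → G.Y} {T : Set (ℂ × ℂ)}
    {α : ℂ → ℂ} {φ : ℂ × ℂ → ℂ} {Φ : ℂ × ℂ → punctured p} {A : ℂ →L[ℝ] ℂ} {κ b ξ : ℂ}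
    (hT : IsOpen T) (hEv : ContMDiffOn 𝓘(ℝ, ℂ × ℂ) (𝓡 4) ∞ Ev T) (hΨT : (α b, φ (b, ξ)) ∈ T)
    (hEvinj : Injective (mfderiv 𝓘(ℝ, ℂ × ℂ) (𝓡 4) Ev (α b, φ (b, ξ))))
    (hαd : HasFDerivAt α A b) (hA : Injective A) (hφ : DifferentiableAt ℝ φ (b, ξ))
    (hκ : HasDerivAt (fun ξ' => φ (b, ξ')) κ ξ) (hκ0 : κ ≠ 0)
    (hpt : Ev (α b, φ (b, ξ)) = G.inP (Φ (b, ξ)))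
    (hΦ : Φ =ᶠ[𝓝 (b, ξ)] fun q => G.inPInv (Ev (α q.1, φ q))) :
    Injective (mfderiv 𝓘(ℝ, ℂ × ℂ) (𝓡 4) Φ (b, ξ)) := by
  -- the differential of `Ψ`
  set Ψ : ℂ × ℂ → ℂ × ℂ := fun q => (α q.1, φ q) with hΨ
  set L : ℂ × ℂ →L[ℝ] ℂ × ℂ := (A.comp (ContinuousLinearMap.fst ℝ ℂ ℂ)).prod (fderiv ℝ φ (b, ξ))
    with hL
  have hΨd : HasFDerivAt Ψ L (b, ξ) := (hαd.comp (b, ξ) hasFDerivAt_fst).prodMk hφ.hasFDerivAt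
  -- the partial derivative of `φ` in `ξ`
  have hslice : HasFDerivAt (fun ξ' => φ (b, ξ'))
      ((fderiv ℝ φ (b, ξ)).comp (ContinuousLinearMap.inr ℝ ℂ ℂ)) ξ :=
    hφ.hasFDerivAt.comp ξ (hasFDerivAt_prodMk_right b ξ)
  have hslice' : HasFDerivAt (fun ξ' => φ (b, ξ'))
      ((ContinuousLinearMap.smulRight (1 : ℂ →L[ℂ] ℂ) κ).restrictScalars ℝ) ξ :=
    hκ.hasFDerivAt.restrictScalars ℝ
  have hpartial : ∀ v : ℂ, fderiv ℝ φ (b, ξ) (0, v) = v * κ := by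
    intro v
    have e := congrArg (fun M : ℂ →L[ℝ] ℂ => M v) (hslice.unique hslice')
    simpa using e
  have hLinj : Injective L := injective_blockTriangular hA hpartial hκ0
  -- the manifold chain rule
  have hEvd : MDifferentiableAt 𝓘(ℝ, ℂ × ℂ) (𝓡 4) Ev (Ψ (b, ξ)) :=
    (hEv.contMDiffAt (hT.mem_nhds hΨT)).mdifferentiableAt (by simp)
  have hcomp1 : HasMFDerivAt 𝓘(ℝ, ℂ × ℂ) (𝓡 4) (Ev ∘ Ψ) (b, ξ)
      ((mfderiv 𝓘(ℝ, ℂ × ℂ) (𝓡 4) Ev (Ψ (b, ξ))).comp L) :=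
    hEvd.hasMFDerivAt.comp (b, ξ) hΨd.hasMFDerivAt
  have hinv : HasMFDerivAt (𝓡 4) (𝓡 4) G.inPInv (Ev (Ψ (b, ξ)))
      (ContinuousLinearMap.id ℝ (EuclideanSpace ℝ (Fin 4))) := by
    have h := G.hasMFDerivAt_inPInv (Φ (b, ξ))
    rw [← hpt] at h
    exact h
  have hcomp2 := hinv.comp (b, ξ) hcomp1
  have hmf : mfderiv 𝓘(ℝ, ℂ × ℂ) (𝓡 4) Φ (b, ξ) =
      (ContinuousLinearMap.id ℝ (EuclideanSpace ℝ (Fin 4))).comp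
        ((mfderiv 𝓘(ℝ, ℂ × ℂ) (𝓡 4) Ev (Ψ (b, ξ))).comp L) := by
    rw [hΦ.mfderiv_eq]
    exact hcomp2.mfderiv
  rw [hmf]
  exact fun v₁ v₂ h => hLinj (hEvinj h)

/-- **Joint smoothness and injective differential of the family of renormalised leaves.** See the
module docstring. [cite: Wendl2018, proof of Prop. 2.53 (p. 65)] -/
theorem leafJoint {U V : ℂ → ℂ → G.Y} {ε ε₁ δ : ℝ} {b₀ : ℂ} {wz α cf df : ℂ → ℂ}
    {Floc : ℂ → ℂ → punctured p}
    (hEvU : ContMDiffOn 𝓘(ℝ, ℂ × ℂ) (𝓡 4) ∞ (fun q : ℂ × ℂ => U q.1 q.2) (ball 0 ε ×ˢ univ))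
    (hEvV : ContMDiffOn 𝓘(ℝ, ℂ × ℂ) (𝓡 4) ∞ (fun q : ℂ × ℂ => V q.1 q.2) (ball 0 ε ×ˢ univ))
    (hinj : ∀ q ∈ ball (0 : ℂ) ε ×ˢ (univ : Set ℂ),
      Injective (mfderiv 𝓘(ℝ, ℂ × ℂ) (𝓡 4) (fun q : ℂ × ℂ => U q.1 q.2) q) ∧
      Injective (mfderiv 𝓘(ℝ, ℂ × ℂ) (𝓡 4) (fun q : ℂ × ℂ => V q.1 q.2) q))
    (hε₁ε : ε₁ ≤ ε)
    (hwz : ContDiffOn ℝ ∞ wz (ball 0 ε₁)) (hcf : ContDiffOn ℝ ∞ cf (ball 0 ε₁))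
    (hdf : ContDiffOn ℝ ∞ df (ball 0 ε₁)) (hcf0 : ∀ a ∈ ball (0 : ℂ) ε₁, cf a ≠ 0)
    (hα : ContDiffOn ℝ ∞ α (ball b₀ δ))
    (hαmaps : ∀ b ∈ ball b₀ δ, α b ∈ ball (0 : ℂ) ε₁)
    (hDα : ∀ b ∈ ball b₀ δ, Bijective (fderiv ℝ α b))
    (hA : ∀ b ∈ ball b₀ δ, ∀ ξ : ℂ,
      1 + wz (α b) * (cf (α b) * (ξ - df (α b))) ≠ 0 →
        G.inP (Floc b ξ) = U (α b)
          ((cf (α b) * (ξ - df (α b))) / (1 + wz (α b) * (cf (α b) * (ξ - df (α b))))))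
    (hB : ∀ b ∈ ball b₀ δ, ∀ ξ : ℂ, cf (α b) * (ξ - df (α b)) ≠ 0 →
        G.inP (Floc b ξ) = V (α b) (wz (α b) + (cf (α b) * (ξ - df (α b)))⁻¹)) :
    ContMDiffOn 𝓘(ℝ, ℂ × ℂ) (𝓡 4) ∞ (fun q : ℂ × ℂ => Floc q.1 q.2)
        ((ball b₀ δ) ×ˢ (univ : Set ℂ)) ∧
    (∀ q : ℂ × ℂ, q.1 ∈ ball b₀ δ →
        Injective (mfderiv 𝓘(ℝ, ℂ × ℂ) (𝓡 4) (fun q : ℂ × ℂ => Floc q.1 q.2) q)) ∧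
    (∀ b ∈ ball b₀ δ, ContMDiff 𝓘(ℝ, ℂ) (𝓡 4) ∞ (Floc b)) ∧
    (∀ b ∈ ball b₀ δ, ∀ ξ : ℂ, Injective (mfderiv 𝓘(ℝ, ℂ) (𝓡 4) (Floc b) ξ)) := by
  -- abbreviations (kept opaque, with unfolding equations)
  obtain ⟨sc, hsc⟩ : ∃ sc : ℂ × ℂ → ℂ, ∀ q, sc q = cf (α q.1) * (q.2 - df (α q.1)) :=
    ⟨_, fun _ => rfl⟩
  obtain ⟨w0, hw0⟩ : ∃ w0 : ℂ × ℂ → ℂ, ∀ q, w0 q = wz (α q.1) := ⟨_, fun _ => rfl⟩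
  obtain ⟨φA, hφA⟩ : ∃ φ : ℂ × ℂ → ℂ, ∀ q, φ q = sc q / (1 + w0 q * sc q) := ⟨_, fun _ => rfl⟩
  obtain ⟨φB, hφB⟩ : ∃ φ : ℂ × ℂ → ℂ, ∀ q, φ q = w0 q + (sc q)⁻¹ := ⟨_, fun _ => rfl⟩
  set Ω : Set (ℂ × ℂ) := ball b₀ δ ×ˢ (univ : Set ℂ) with hΩ
  set Φ : ℂ × ℂ → punctured p := fun q => Floc q.1 q.2 with hΦ
  set T : Set (ℂ × ℂ) := ball (0 : ℂ) ε ×ˢ (univ : Set ℂ) with hT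
  have hTo : IsOpen T := isOpen_ball.prod isOpen_univ
  have hΩo : IsOpen Ω := isOpen_ball.prod isOpen_univ
  have hΩ1 : ∀ q ∈ Ω, q.1 ∈ ball b₀ δ := fun q hq => (mem_prod.1 hq).1
  have hαq' : ∀ q ∈ Ω, α q.1 ∈ ball (0 : ℂ) ε₁ := fun q hq => hαmaps _ (hΩ1 q hq)
  have hαT : ∀ q ∈ Ω, ∀ s : ℂ, (α q.1, s) ∈ T := fun q hq s =>
    ⟨ball_subset_ball hε₁ε (hαq' q hq), mem_univ _⟩
  -- smoothness of the coefficient maps on `Ω`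
  have hαq : ContDiffOn ℝ ∞ (fun q : ℂ × ℂ => α q.1) Ω :=
    hα.comp contDiffOn_fst fun q hq => hΩ1 q hq
  have hw0s : ContDiffOn ℝ ∞ w0 Ω := (hwz.comp hαq hαq').congr fun q _ => hw0 q
  have hcfs : ContDiffOn ℝ ∞ (fun q : ℂ × ℂ => cf (α q.1)) Ω := hcf.comp hαq hαq'
  have hdfs : ContDiffOn ℝ ∞ (fun q : ℂ × ℂ => df (α q.1)) Ω := hdf.comp hαq hαq'
  have hscs : ContDiffOn ℝ ∞ sc Ω := (hcfs.mul (contDiffOn_snd.sub hdfs)).congr fun q _ => hsc q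
  -- the two pieces
  set OA : Set (ℂ × ℂ) := Ω ∩ (fun q => 1 + w0 q * sc q) ⁻¹' {0}ᶜ with hOA
  set OB : Set (ℂ × ℂ) := Ω ∩ sc ⁻¹' {0}ᶜ with hOB
  have hOAo : IsOpen OA :=
    (continuousOn_const.add (hw0s.continuousOn.mul hscs.continuousOn)).isOpen_inter_preimage hΩo
      isOpen_compl_singleton
  have hOBo : IsOpen OB := hscs.continuousOn.isOpen_inter_preimage hΩo isOpen_compl_singleton
  have hOA2 : ∀ q ∈ OA, 1 + w0 q * sc q ≠ 0 := fun q hq => hq.2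
  have hOB2 : ∀ q ∈ OB, sc q ≠ 0 := fun q hq => hq.2
  have hcover : ∀ q ∈ Ω, q ∈ OA ∨ q ∈ OB := by
    intro q hq
    by_cases h0 : sc q = 0
    · refine Or.inl ⟨hq, ?_⟩
      show 1 + w0 q * sc q ≠ 0
      rw [h0, mul_zero, add_zero]; exact one_ne_zero
    · exact Or.inr ⟨hq, h0⟩
  -- the formulas on the pieces
  have hΦA : ∀ q ∈ OA, G.inP (Φ q) = U (α q.1) (φA q) := by
    intro q hq
    have h1 : 1 + wz (α q.1) * (cf (α q.1) * (q.2 - df (α q.1))) ≠ 0 := by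
      have h := hOA2 q hq; rwa [hw0, hsc] at h
    show G.inP (Floc q.1 q.2) = U (α q.1) (φA q)
    rw [hA q.1 (hΩ1 q hq.1) q.2 h1, hφA, hsc, hw0]
  have hΦB : ∀ q ∈ OB, G.inP (Φ q) = V (α q.1) (φB q) := by
    intro q hq
    have h1 : cf (α q.1) * (q.2 - df (α q.1)) ≠ 0 := by
      have h := hOB2 q hq; rwa [hsc] at h
    show G.inP (Floc q.1 q.2) = V (α q.1) (φB q)
    rw [hB q.1 (hΩ1 q hq.1) q.2 h1, hφB, hsc, hw0]
  -- smoothness of the pieces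
  have hφAs : ContDiffOn ℝ ∞ φA OA := by
    have h1 : ContDiffOn ℝ ∞ (fun q => sc q * (1 + w0 q * sc q)⁻¹) OA :=
      (hscs.mono inter_subset_left).mul
        (((contDiffOn_const.add (hw0s.mul hscs)).mono inter_subset_left).inv hOA2)
    exact h1.congr fun q _ => by rw [hφA, div_eq_mul_inv]
  have hφBs : ContDiffOn ℝ ∞ φB OB := by
    have h1 : ContDiffOn ℝ ∞ (fun q => w0 q + (sc q)⁻¹) OB :=
      (hw0s.mono inter_subset_left).add ((hscs.mono inter_subset_left).inv hOB2)
    exact h1.congr fun q _ => by rw [hφB]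
  have hΦAs : ContMDiffOn 𝓘(ℝ, ℂ × ℂ) (𝓡 4) ∞ Φ OA := by
    have hΨ : ContMDiffOn 𝓘(ℝ, ℂ × ℂ) 𝓘(ℝ, ℂ × ℂ) ∞ (fun q => (α q.1, φA q)) OA :=
      ((hαq.mono inter_subset_left).prodMk hφAs).contMDiffOn
    have h1 : ContMDiffOn 𝓘(ℝ, ℂ × ℂ) (𝓡 4) ∞ (fun q => U (α q.1) (φA q)) OA :=
      hEvU.comp hΨ fun q hq => hαT q hq.1 _
    have h2 : ContMDiffOn 𝓘(ℝ, ℂ × ℂ) (𝓡 4) ∞ (fun q => G.inPInv (U (α q.1) (φA q))) OA :=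
      G.contMDiffOn_inPInv.comp h1 fun q hq => ⟨Φ q, hΦA q hq⟩
    refine h2.congr fun q hq => ?_
    show Φ q = G.inPInv (U (α q.1) (φA q))
    rw [← hΦA q hq, G.inPInv_inP]
  have hΦBs : ContMDiffOn 𝓘(ℝ, ℂ × ℂ) (𝓡 4) ∞ Φ OB := by
    have hΨ : ContMDiffOn 𝓘(ℝ, ℂ × ℂ) 𝓘(ℝ, ℂ × ℂ) ∞ (fun q => (α q.1, φB q)) OB :=
      ((hαq.mono inter_subset_left).prodMk hφBs).contMDiffOn
    have h1 : ContMDiffOn 𝓘(ℝ, ℂ × ℂ) (𝓡 4) ∞ (fun q => V (α q.1) (φB q)) OB :=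
      hEvV.comp hΨ fun q hq => hαT q hq.1 _
    have h2 : ContMDiffOn 𝓘(ℝ, ℂ × ℂ) (𝓡 4) ∞ (fun q => G.inPInv (V (α q.1) (φB q))) OB :=
      G.contMDiffOn_inPInv.comp h1 fun q hq => ⟨Φ q, hΦB q hq⟩
    refine h2.congr fun q hq => ?_
    show Φ q = G.inPInv (V (α q.1) (φB q))
    rw [← hΦB q hq, G.inPInv_inP]
  -- joint smoothness
  have hΦs : ContMDiffOn 𝓘(ℝ, ℂ × ℂ) (𝓡 4) ∞ Φ Ω := by
    refine contMDiffOn_of_locally_contMDiffOn fun q hq => ?_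
    rcases hcover q hq with hqA | hqB
    · exact ⟨OA, hOAo, hqA, hΦAs.mono inter_subset_right⟩
    · exact ⟨OB, hOBo, hqB, hΦBs.mono inter_subset_right⟩
  -- injectivity of the joint differential
  have hDinj : ∀ b ∈ ball b₀ δ, ∀ ξ : ℂ, Injective (mfderiv 𝓘(ℝ, ℂ × ℂ) (𝓡 4) Φ (b, ξ)) := by
    intro b hb ξ
    have hq : (b, ξ) ∈ Ω := ⟨hb, mem_univ _⟩
    have hαd : HasFDerivAt α (fderiv ℝ α b) b :=
      ((hα.contDiffAt (isOpen_ball.mem_nhds hb)).differentiableAt (by simp)).hasFDerivAt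
    have hAinj : Injective (fderiv ℝ α b) := (hDα b hb).1
    set c : ℂ := cf (α b) with hc
    set dd : ℂ := df (α b) with hdd
    set w : ℂ := wz (α b) with hw
    have hc0 : c ≠ 0 := hcf0 _ (hαmaps b hb)
    have hN : HasDerivAt (fun ξ' : ℂ => c * (ξ' - dd)) c ξ := by
      simpa using ((hasDerivAt_id ξ).sub_const dd).const_mul c
    rcases hcover (b, ξ) hq with hqA | hqB
    · -- piece A
      have hDn0 : 1 + w * (c * (ξ - dd)) ≠ 0 := by
        have h := hOA2 _ hqA; rwa [hw0, hsc] at h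
      have hDn : HasDerivAt (fun ξ' : ℂ => 1 + w * (c * (ξ' - dd))) (w * c) ξ := by
        simpa using (hN.const_mul w).const_add 1
      have hκ : HasDerivAt (fun ξ' => φA (b, ξ')) (c / (1 + w * (c * (ξ - dd))) ^ 2) ξ := by
        have hQ := hN.div hDn hDn0
        have e : (fun ξ' => φA (b, ξ')) = fun ξ' => c * (ξ' - dd) / (1 + w * (c * (ξ' - dd))) :=
          funext fun ξ' => by rw [hφA, hsc, hw0]
        rw [e]
        refine hQ.congr_deriv ?_
        field_simp
        ring
      refine G.injective_mfderiv_of_piece hTo hEvU (hαT _ hq _) (hinj _ (hαT _ hq _)).1 hαd hAinj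
        ((hφAs.contDiffAt (hOAo.mem_nhds hqA)).differentiableAt (by simp)) hκ
        (div_ne_zero hc0 (pow_ne_zero 2 hDn0)) (hΦA _ hqA).symm ?_
      filter_upwards [hOAo.mem_nhds hqA] with q hq'
      rw [← hΦA q hq', G.inPInv_inP]
    · -- piece B
      have hs0 : c * (ξ - dd) ≠ 0 := by
        have h := hOB2 _ hqB; rwa [hsc] at h
      have hκ : HasDerivAt (fun ξ' => φB (b, ξ')) (-c / (c * (ξ - dd)) ^ 2) ξ := by
        have hQ := (hN.inv hs0).const_add w
        have e : (fun ξ' => φB (b, ξ')) = fun ξ' => w + (c * (ξ' - dd))⁻¹ :=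
          funext fun ξ' => by rw [hφB, hsc, hw0]
        rw [e]
        refine hQ.congr_deriv ?_
        ring
      refine G.injective_mfderiv_of_piece hTo hEvV (hαT _ hq _) (hinj _ (hαT _ hq _)).2 hαd hAinj
        ((hφBs.contDiffAt (hOBo.mem_nhds hqB)).differentiableAt (by simp)) hκ
        (div_ne_zero (neg_ne_zero.2 hc0) (pow_ne_zero 2 hs0)) (hΦB _ hqB).symm ?_
      filter_upwards [hOBo.mem_nhds hqB] with q hq'
      rw [← hΦB q hq', G.inPInv_inP]
  -- slices
  have hsl : ∀ b ∈ ball b₀ δ, ContMDiff 𝓘(ℝ, ℂ) (𝓡 4) ∞ (Floc b) := fun b hb =>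
    hΦs.comp_contMDiff (f := fun ξ : ℂ => (b, ξ))
      (contDiff_prodMk_right (𝕜 := ℝ) (n := ∞) b).contMDiff fun ξ => ⟨hb, mem_univ _⟩
  have hsl' : ∀ b ∈ ball b₀ δ, ∀ ξ : ℂ, Injective (mfderiv 𝓘(ℝ, ℂ) (𝓡 4) (Floc b) ξ) := by
    intro b hb ξ
    have hΦd : MDifferentiableAt 𝓘(ℝ, ℂ × ℂ) (𝓡 4) Φ (b, ξ) :=
      (hΦs.contMDiffAt (hΩo.mem_nhds ⟨hb, mem_univ _⟩)).mdifferentiableAt (by simp)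
    have hs : HasMFDerivAt 𝓘(ℝ, ℂ) 𝓘(ℝ, ℂ × ℂ) (fun ξ' : ℂ => (b, ξ')) ξ
        (ContinuousLinearMap.inr ℝ ℂ ℂ) :=
      (hasFDerivAt_prodMk_right b ξ).hasMFDerivAt
    have hmf : mfderiv 𝓘(ℝ, ℂ) (𝓡 4) (Floc b) ξ =
        (mfderiv 𝓘(ℝ, ℂ × ℂ) (𝓡 4) Φ (b, ξ)).comp (ContinuousLinearMap.inr ℝ ℂ ℂ) :=
      (hΦd.hasMFDerivAt.comp ξ hs).mfderiv
    rw [hmf]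
    intro v₁ v₂ h
    have h' : ((0 : ℂ), v₁) = ((0 : ℂ), v₂) := hDinj b hb ξ h
    exact (Prod.mk.injEq _ _ _ _ ▸ h').2
  exact ⟨hΦs, fun q hq => hDinj q.1 hq q.2, hsl, hsl'⟩

end PencilEnd

end Literature.Geometry.Symplectic
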